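import Summits.QuantumFields.YangMills.Theorems.LangevinControlUVFemtoCurvatureTwoPointDefs
import Summits.QuantumFields.YangMills.Theorems.LangevinControlUVFemtoCurvatureTwoPointEncoding
import Summits.QuantumFields.YangMills.Theorems.LangevinControlUVFemtoCurvatureTwoPointRateFreeAux

/-!
# Route `LangevinControlUV`, item `FemtoCurvatureTwoPoint` (stmt-QuantumFields-9363), line `generic-step-gamma-encoding`:
# the transfer `FixedTorusTwoSided ⇒ FemtoCurvatureTwoPoint` (generic-step encoding, measure side)

Support file (`--supports stmt-QuantumFields-9363`). The PROVED transfer of the line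
`generic-step-gamma-encoding` (skeleton `Cruxes/FemtoCurvatureTwoPoint/Lines/generic_step_gamma_encoding.lean`,
§§ "Torus-distance bookkeeping", "Merging the two analytic stubs into C⁺", "The transfer C⁺ ⇒ crux"), landed from the
kernel-checked skeleton against the tree vocabulary `…TwoPointDefs` (K2⁻ `AxisLowerFixedTorus`, K2⁺ `PairUpperFixedTorus`,
C⁺ `FixedTorusTwoSided`, `CruxAt`) and the landed encoding arithmetic `…TwoPointEncoding` (`stepIdx`, `ladder`, `alphaEnc`,
`exists_generic`, `gammaEnc`, `band_to_levels`, `allpairs_to_levels`):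

* `fixedTorusTwoSided_of : AxisLowerFixedTorus → PairUpperFixedTorus → FixedTorusTwoSided` (merge thresholds; the axis upper
  bound is the pair bound at `(0, n e₂)` where `dist = n`, `dist_axis`);
* `encoding_at` — at fixed `(G, r)`, fixed-torus two-sided `β⁻²` bounds with per-torus thresholds `B(L)` and ONE pair of
  constants give the item's body `CruxAt r`: unit map `a(β) = α_{k(β)}` (generic dyadic step values over the threshold ladder
  of `B`), shape `Γ(√m · α_k) = 4^{-k}`, `ℓ₀ = β₀ = 1`, constants `c/4`, `|C|`;
* `encoding : FixedTorusTwoSided → ∀ G r, CruxAt r`, `cruxAt_of_bounds`, and the by-name form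
  `femtoCurvatureTwoPoint_of_fixedTorusTwoSided : FixedTorusTwoSided → FemtoCurvatureTwoPoint`.

This is the converse direction of the disprover's dissection (`Cruxes/FemtoCurvatureTwoPoint/Disproof.lean` § Dissection:
any proof of the item as typed is a fixed-torus statement with `L`-uniform constants). An earlier submission of this file
(p116540, lead c2) bounced only for re-declaring `dist_eq_sqrt_nat`, which is imported here from `…TwoPointRateFreeAux`.
-/

set_option autoImplicit false

noncomputable section

open scoped BigOperators Matrix
open MeasureTheory Filter Topology ProbabilityTheory

namespace Summit.QuantumFields.YangMills.Cruxes.FemtoCurvatureTwoPoint.GenericStepGammaEncoding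

open Literature.MathematicalPhysics.QuantumFieldTheory
open Summit.QuantumFields.YangMills.Theorems.FemtoCurvatureTwoPoint.RateFree (dist_eq_sqrt_nat)

/-! ## § Torus-distance bookkeeping -/

/-- The axis site `n e₂` is not the origin for `1 ≤ n`, `8n ≤ L`. -/
theorem axis_ne {L n : ℕ} (hn : 1 ≤ n) (h8 : 8 * n ≤ L) :
    (0 : Fin 4 → ZMod L) ≠ Pi.single (2 : Fin 4) ((n : ℕ) : ZMod L) := by
  intro h
  have h2 := congr_fun h (2 : Fin 4)
  simp only [Pi.zero_apply, Pi.single_eq_same] at h2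
  have hdvd : L ∣ n := (ZMod.natCast_eq_zero_iff n L).1 h2.symm
  have hL : L ≤ n := Nat.le_of_dvd (by omega) hdvd
  omega

/-- The torus distance from the origin to `n e₂` is `n` (`8n ≤ L`). -/
theorem dist_axis {L n : ℕ} [NeZero L] (hn : 1 ≤ n) (h8 : 8 * n ≤ L) :
    Real.sqrt (∑ k : Fin 4,
      ((((0 : Fin 4 → ZMod L) k -
        (Pi.single (2 : Fin 4) ((n : ℕ) : ZMod L) : Fin 4 → ZMod L) k).valMinAbs : ℤ) : ℝ) ^ 2)
      = n := by
  set y : Fin 4 → ZMod L := Pi.single (2 : Fin 4) ((n : ℕ) : ZMod L) with hy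
  have hval : ((n : ℕ) : ZMod L).val = n := ZMod.val_natCast_of_lt (by omega)
  have hhalf : ((n : ℕ) : ZMod L).valMinAbs = n := ZMod.valMinAbs_natCast_of_le_half (by omega)
  have hneg : (-((n : ℕ) : ZMod L)).valMinAbs = -(n : ℤ) := by
    rw [ZMod.valMinAbs_neg_of_ne_half, hhalf]
    rw [hval]; omega
  have h0 : y 0 = 0 := by simp [hy]
  have h1 : y 1 = 0 := by simp [hy]
  have h2 : y 2 = ((n : ℕ) : ZMod L) := by simp [hy]
  have h3 : y 3 = 0 := by simp [hy]
  have hsum : ∑ k : Fin 4, ((((0 : Fin 4 → ZMod L) k - y k).valMinAbs : ℤ) : ℝ) ^ 2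
      = (n : ℝ) ^ 2 := by
    simp only [Fin.sum_univ_four, Pi.zero_apply, zero_sub, h0, h1, h2, h3, neg_zero,
      ZMod.valMinAbs_zero, hneg]
    push_cast
    ring
  rw [hsum, Real.sqrt_sq (Nat.cast_nonneg n)]

/-! ## § Merging the two analytic stubs into C⁺ -/

/-- `K2⁻ ∧ K2⁺ ⇒ C⁺`: instantiate the Borel structure, discharge the defining equations by `rfl`,
merge the thresholds; the axis upper bound is the pair bound at `(0, n e₂)`, where `dist = n`. -/
theorem fixedTorusTwoSided_of : AxisLowerFixedTorus → PairUpperFixedTorus → FixedTorusTwoSided := by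
  intro hA hU G _ _ _ _ hG
  letI : MeasurableSpace G := borel G
  haveI : BorelSpace G := ⟨rfl⟩
  intro r
  obtain ⟨B₁, c, hc, HA⟩ := hA G hG r
  obtain ⟨B₂, C, HU⟩ := hU G hG r
  refine ⟨fun L => max (B₁ L) (B₂ L), c, |C|, hc, ?_⟩
  intro L _ β hβ
  have hA' := HA L β ((le_max_left _ _).trans hβ) _ _ rfl rfl
  have hU' := HU L β ((le_max_right _ _).trans hβ) _ _ rfl rfl
  refine ⟨fun n hn h8 => ⟨hA' n hn h8, ?_⟩,
    fun x y i j i' j' hxy hij hij' => (hU' x y i j i' j' hxy hij hij').trans (le_abs_self C)⟩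
  have h01 : (0 : Fin 4) ≠ 1 := by decide
  have h := hU' 0 (Pi.single (2 : Fin 4) ((n : ℕ) : ZMod L)) 0 1 0 1 (axis_ne hn h8) h01 h01
  have key : ∀ (Y D : ℝ), D = n → β ^ 2 * (|Y| * D ^ 8) ≤ C → β ^ 2 * ((n : ℝ) ^ 8 * Y) ≤ |C| := by
    intro Y D hD hY
    subst hD
    have h1 : (n : ℝ) ^ 8 * Y ≤ |Y| * (n : ℝ) ^ 8 := by
      rw [mul_comm]; exact mul_le_mul_of_nonneg_right (le_abs_self Y) (by positivity)
    have h2 : β ^ 2 * ((n : ℝ) ^ 8 * Y) ≤ β ^ 2 * (|Y| * (n : ℝ) ^ 8) :=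
      mul_le_mul_of_nonneg_left h1 (sq_nonneg β)
    exact h2.trans (hY.trans (le_abs_self C))
  exact key _ _ (dist_axis (L := L) hn h8) h

/-! ## § The transfer `C⁺ ⇒ crux` -/

/-- **Encoding at fixed data (the card's `crux_of_encoding`, PROVED).** From the fixed-torus
two-sided clauses at `(G, r)` with thresholds `B` and constants `0 < c`, `C`, the crux body at
`(G, r)`: `ℓ₀ = 1`, `β₀ = 1`, unit map `a(β) = α_{k(β)}`, `α_k = (1 + t 2^{-k})/(L_k + 1)` (`t`
generic, `L_k` the threshold ladder of `B`), shape `Γ(√m α_k) = 4^{-k}` (else `1`), constants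
`c/4` and `|C|`. -/
theorem encoding_at {G : Type} [Group G] [TopologicalSpace G] [IsTopologicalGroup G] [CompactSpace G]
    [MeasurableSpace G] [BorelSpace G] (r : LatticeRep G) {B : ℕ → ℝ} {c C : ℝ} (hc : 0 < c)
    (H : ∀ (L : ℕ) [NeZero L] (β : ℝ), B L ≤ β →
        let P : (Fin 4 → ZMod L) → Fin 4 → Fin 4 → GaugeConfig 4 L G → ℝ :=
          fun x i j U => (r.N : ℝ) - (r.ρ (plaquetteHolonomy U x i j)).trace.re
        let E : (GaugeConfig 4 L G → ℝ) → ℝ := fun F => wilsonExpectation (d := 4) (L := L) r.ρ β F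
        let cov : (GaugeConfig 4 L G → ℝ) → (GaugeConfig 4 L G → ℝ) → ℝ :=
          fun F F' => E (fun U => F U * F' U) - E F * E F'
        let dist : (Fin 4 → ZMod L) → (Fin 4 → ZMod L) → ℝ :=
          fun x y => Real.sqrt (∑ k : Fin 4, (((x k - y k).valMinAbs : ℤ) : ℝ) ^ 2)
        (∀ n : ℕ, 1 ≤ n → 8 * n ≤ L →
            c ≤ β ^ 2 * ((n : ℝ) ^ 8 * cov (P 0 0 1) (P (Pi.single (2 : Fin 4) ((n : ℕ) : ZMod L)) 0 1)) ∧
            β ^ 2 * ((n : ℝ) ^ 8 * cov (P 0 0 1) (P (Pi.single (2 : Fin 4) ((n : ℕ) : ZMod L)) 0 1)) ≤ C) ∧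
        (∀ (x y : Fin 4 → ZMod L) (i j i' j' : Fin 4), x ≠ y → i ≠ j → i' ≠ j' →
            β ^ 2 * (|cov (P x i j) (P y i' j')| * dist x y ^ 8) ≤ C)) :
    CruxAt r := by
  -- generic step values over the threshold ladder of `B`
  obtain ⟨t, ht1, ht2, hgen⟩ :=
    exists_generic (fun k => ((ladder B k : ℝ) + 1)⁻¹) (fun k => by positivity)
  have ht0 : 0 < t := by linarith
  have hgen' : ∀ (k k' m m' : ℕ), k ≠ k' → 1 ≤ m → 1 ≤ m' →
      Real.sqrt m * alphaEnc B t k ≠ Real.sqrt m' * alphaEnc B t k' := hgen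
  refine ⟨fun β => alphaEnc B t (stepIdx β), gammaEnc (alphaEnc B t), 1, 1, c / 4, |C|, one_pos,
    by positivity, fun β => alphaEnc_pos B ht0.le _, ?_,
    fun s _ _ => ⟨gammaEnc_pos _ s, gammaEnc_le_one _ s⟩, ?_⟩
  · -- `a → 0`: the ladder is unbounded
    refine Metric.tendsto_atTop.2 fun ε hε => ?_
    obtain ⟨L₀, hL₀⟩ := exists_nat_one_div_lt (half_pos hε)
    obtain ⟨K, hK⟩ := pow_unbounded_of_one_lt (env B L₀) (by norm_num : (1 : ℝ) < 2)
    refine ⟨(2 : ℝ) ^ K, fun β hβ => ?_⟩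
    have hk : K ≤ stepIdx β := le_stepIdx_of_le hβ
    have henv : env B L₀ ≤ (2 : ℝ) ^ stepIdx β :=
      hK.le.trans (pow_le_pow_right₀ (by norm_num) hk)
    have hL : L₀ ≤ ladder B (stepIdx β) := le_ladder B henv
    have hL' : (L₀ : ℝ) + 1 ≤ (ladder B (stepIdx β) : ℝ) + 1 := by
      exact_mod_cast Nat.succ_le_succ hL
    rw [Real.dist_eq, sub_zero, abs_of_pos (alphaEnc_pos B ht0.le _)]
    calc alphaEnc B t (stepIdx β) ≤ 2 / ((ladder B (stepIdx β) : ℝ) + 1) := alphaEnc_le B ht2 _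
      _ ≤ 2 / ((L₀ : ℝ) + 1) := div_le_div_of_nonneg_left (by norm_num) (by positivity) hL'
      _ = 2 * (1 / ((L₀ : ℝ) + 1)) := by ring
      _ < 2 * (ε / 2) := by gcongr
      _ = ε := by ring
  · -- the clauses on a femto torus in step `k`
    intro L _ β hβ hLa
    have hβ1 : 1 ≤ β := hβ
    have h2k : (2 : ℝ) ^ stepIdx β ≤ β := two_pow_stepIdx_le hβ1
    have hβlt : β < (2 : ℝ) ^ (stepIdx β + 1) := lt_two_pow_stepIdx_succ β
    have hL1 : 1 ≤ L := Nat.one_le_iff_ne_zero.2 (NeZero.ne L)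
    have hLa' : (L : ℝ) * alphaEnc B t (stepIdx β) ≤ 1 := hLa
    have hLk : L ≤ ladder B (stepIdx β) := le_ladder_of_femto B ht0 hLa'
    have hBL : B L ≤ β := threshold_le B hL1 hLk h2k
    have HH := H L β hBL
    obtain ⟨hax, hall⟩ := HH
    refine ⟨fun n hn h8 => ?_, fun x y i j i' j' hxy hij hij' => ?_⟩
    · obtain ⟨h_lo, h_hi⟩ := hax n hn h8
      have hΓ : gammaEnc (alphaEnc B t) ((n : ℝ) * alphaEnc B t (stepIdx β)) =
          ((4 : ℝ) ^ stepIdx β)⁻¹ := by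
        have e : (n : ℝ) * alphaEnc B t (stepIdx β) =
            Real.sqrt ((n ^ 2 : ℕ) : ℝ) * alphaEnc B t (stepIdx β) := by
          congr 1
          push_cast
          rw [Real.sqrt_sq (Nat.cast_nonneg n)]
        rw [e]
        exact gammaEnc_eq hgen' (stepIdx β) (n ^ 2) (by nlinarith)
      rw [hΓ]
      exact band_to_levels h2k hβlt hc h_lo h_hi
    · have hxy' := hall x y i j i' j' hxy hij hij'
      obtain ⟨m, hm, hdist⟩ := dist_eq_sqrt_nat x y hxy
      dsimp only at hxy' ⊢
      rw [hdist] at hxy' ⊢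
      have hΓ : gammaEnc (alphaEnc B t) (Real.sqrt (m : ℝ) * alphaEnc B t (stepIdx β)) =
          ((4 : ℝ) ^ stepIdx β)⁻¹ :=
        gammaEnc_eq hgen' (stepIdx β) m hm
      rw [hΓ]
      exact allpairs_to_levels h2k (by positivity) hxy'

/-- **Transfer `C⁺ ⇒ crux` (the card's `crux_of_encoding`, PROVED)**, in the unbundled form
`∀ G r, CruxAt r`; `femtoCurvatureTwoPoint_iff_cruxAt.2 (encoding h)` is the item itself
(`femtoCurvatureTwoPoint_of_fixedTorusTwoSided`). -/
theorem encoding (hC : FixedTorusTwoSided) :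
    ∀ (G : Type) [Group G] [TopologicalSpace G] [IsTopologicalGroup G] [CompactSpace G],
      IsCompactSimpleLieGroup G →
        letI : MeasurableSpace G := borel G
        haveI : BorelSpace G := ⟨rfl⟩
        ∀ r : LatticeRep G, CruxAt r := by
  intro G _ _ _ _ hG r
  letI : MeasurableSpace G := borel G
  haveI : BorelSpace G := ⟨rfl⟩
  obtain ⟨B, c, C, hc, H⟩ := hC G hG r
  exact encoding_at r hc H

/-- `K2⁻ ∧ K2⁺ ⇒` the crux body at every `(G, r)` (unbundled form; registered name). -/
theorem cruxAt_of_bounds (hA : AxisLowerFixedTorus) (hU : PairUpperFixedTorus) :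
    ∀ (G : Type) [Group G] [TopologicalSpace G] [IsTopologicalGroup G] [CompactSpace G],
      IsCompactSimpleLieGroup G →
        letI : MeasurableSpace G := borel G
        haveI : BorelSpace G := ⟨rfl⟩
        ∀ r : LatticeRep G, CruxAt r :=
  encoding (fixedTorusTwoSided_of hA hU)

/-- **By-name form of the transfer**: the fixed-torus two-sided bounds C⁺ imply the typed item
`FemtoCurvatureTwoPoint` (definitional unbundling `femtoCurvatureTwoPoint_iff_cruxAt` + `encoding`). -/
theorem femtoCurvatureTwoPoint_of_fixedTorusTwoSided (hC : FixedTorusTwoSided) :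
    Summit.QuantumFields.YangMills.Theses.LangevinControlUV.FemtoCurvatureTwoPoint :=
  femtoCurvatureTwoPoint_iff_cruxAt.2 (encoding hC)

end Summit.QuantumFields.YangMills.Cruxes.FemtoCurvatureTwoPoint.GenericStepGammaEncoding

end
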